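import Summits.BirchSwinnertonDyer.Rank1Residual.X12.JZeroThreeDescent
import Summits.BirchSwinnertonDyer.Rank1Residual.Partition.CornersCMDecide
import Summits.BirchSwinnertonDyer.Rank1Residual.X12.CMIsogenyInvariance
import Summits.BirchSwinnertonDyer.Rank1Residual.WAll.TargetCMRamifiedSlices
import Literature.NumberTheory.EllipticCurves.GlobalMinimalModelProofs
import Literature.NumberTheory.EllipticCurves.ThreeIsogeny
import Literature.NumberTheory.EllipticCurves.IsogenyTwoTorsionProofs
import Literature.NumberTheory.EllipticCurves.IsogenyIdProofs
import Literature.NumberTheory.EllipticCurves.QuadraticTwistJInvariantProofs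
import Literature.NumberTheory.EllipticCurves.IsogenyQuadraticTwistProofs
import HarnessLib

/-!
# K12r@3 — the ISOGENY NORMAL FORM of the `p = 3` slice: every CM curve over `ℚ` with `3`
# ramified in its CM field is `ℚ`-isogenous to a Mordell curve `y² = x³ + k`, so the leaf
# `WAllCornerFRamifiedAtThree` (= crux C1 `CMRamifiedThreeBSD` of route PrintCFram) is EQUIVALENT
# to its restriction to `j = 0` (cell `bsd-print-cfram`, seat p4, PLAN §2 p4 (b))

HONEST FRAMING (cell `bsd-print-cfram`, run/shared/lean/pub/bsd-print-cfram/, D-0131 (2) print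
tier; verbatim in every file of the seat): the cell works the partition leaf
`CornerF ∧ p ramified in the CM field K` (LADDER-BSD row K7r = B13; W-ALL row 12r) in PARTITION
currency — a leaf or a cell counts only when its theorem is in the kernel BY NAME. This file does
NOT close the `p = 3` slice (no class-wide theorem is in print, bsd-wall-cm K12R3-SCOPING-v1 §3); it
proves a REDUCTION of it, by name and unconditionally except for the standing published facts of
BSD bookkeeping (GZK `hGZK`, modularity `hmod`, Cassels `hCassels`). Nothing here is a Literature
statement; no named fact is introduced. beyond-print: NO (Vélu, Silverman X.5.4, Cassels).

## The mathematics

`CMRamified W 3` for a CM curve `W/ℚ` means `d_K = −3`, i.e. `j(W) ∈ {0, 54000, −12288000}`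
(tree `cmRamified_three_iff_of_hasCM`, `Partition/CornersCMDecide.lean`; ty2's
`O11.LeafInterface.leaf_arith_three` states the same list; the three `j`-invariants of the orders
`ℤ[ζ₃] ⊃ ℤ[√−3] ⊃ ℤ[3ζ₃]` of conductors `1, 2, 3` in `ℚ(√−3)`). The two non-maximal orders are
reached from `j = 0` by a `ℚ`-rational isogeny of degree the conductor:
* `j = 54000`: `y² = x³ − 3x² + 3x` (`= (x − 1)³ + 1`, i.e. `36a1 : y² = x³ + 1` translated to its
  rational `2`-torsion point; `j = 0`) has Vélu `2`-isogenous curve `y² = x³ + 6x² − 3x`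
  (`twoIsogenyCodomain`, Silverman *AEC* III.4.5) with `j = 720³/6912 = 54000`;
* `j = −12288000`: the tree's Vélu pair `E_{6,−4} = [0, 36, 0, −48, 16]` (`j = −12288000`) `~`
  `E'_{6,−4} = [0, 36, 0, 432, 13392]` (`j = 0`) (`ThreeIsogeny`, `isIsogenous_cm27`).
Every curve with `j = j(E)`, `j ∉ {0, 1728}`, is a quadratic twist `C • W = E^{(d)}` (Silverman
X.5.4, tree `exists_variableChange_eq_quadraticTwist_of_j_eq`) and isogenies twist
(`IsIsogenous.quadraticTwist`, Cremona §3.9), so `W ~ E^{(d)} ~ E₀^{(d)}` with `j(E₀^{(d)}) = 0`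
(`exists_isIsogenous_j_eq_zero`); a short model of a `j = 0` curve is `y² = x³ + k`
(`exists_isIsogenous_mordell`). Since `BSD(E, p)`, the analytic rank, CM and `CMRamified` are
`ℚ`-isogeny invariants (Cassels / Faltings / `X12.CMIsogenyInvariance`) and every curve has a
globally minimal model (Néron), the crux C1 = the leaf's RHS
`∀ W min, HasCM → r_an = 1 → CMRamified W 3 → BSDp W 3` is EQUIVALENT to
`∀ W min, j(W) = 0 → r_an = 1 → BSDp W 3` (`cmRamifiedThreeBSD_iff_jZero`), and to the same over
Mordell models; in leaf vocabulary `wAllCornerFRamifiedAtThree_iff_jZero`.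

## Contents
* §1 the two base pairs: `jZeroTwoTorsionModel = [0, −3, 0, 3, 0]` (`j = 0`) and its Vélu
  `2`-isogenous `j54000Model = [0, 6, 0, −3, 0]` (`j = 54000`), `isIsogenous_j54000Model`; the
  `j = −12288000` pair is the tree's `threeTorsionModel 6 (−4) ~ threeIsogenyCodomain 6 (−4)`.
* §2 `exists_isIsogenous_j_eq_zero` (CM ∧ `CMRamified W 3` ⟹ `∃ V`, `j(V) = 0`, `W ~ V`),
  `exists_isIsogenous_mordell` (`∃ k ≠ 0`, `W ~ y² = x³ + k`),
  `exists_isIsogenous_j_eq_zero_minimal` (the same with `V` globally minimal).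
* §3 `cmRamifiedThreeBSD_iff_jZero`, `wAllCornerFRamifiedAtThree_iff_jZero` (granted GZK,
  modularity, Cassels).

References: [cite: SilvermanAEC2009, III.4 Example 4.5, X.5 Prop. 5.4 and Cor. 5.4.1, VIII.8 Cor. 8.3];
[cite: CremonaAlgorithms1997, §3.8 and §3.9 (p. 87), Table 1 (classes 27a, 36a)];
[cite: SilvermanATAEC1994, App. A §3]; [cite: MilneADT2006, Thm. I.7.3]; [cite: Miller2011LMS, §1 and Def. 1.1];
PLAN.md §1 C1 / §2 p4 (b); `X12/O11/RamifiedLeafInterfaceAtThree.lean` (ty2, p534972: the same `j`-list).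
-/

set_option autoImplicit false

noncomputable section

open scoped Classical

open WeierstrassCurve Literature.NumberTheory.EllipticCurves
  Literature.NumberTheory.EllipticCurves.ModularForms
  Literature.NumberTheory.EllipticCurves.Rank1Residual
  Literature.NumberTheory.EllipticCurves.Rank1Residual.Typed

namespace Summit.BirchSwinnertonDyer.Rank1Residual.X12.JZeroThree

/-! ## §1 The base pairs -/

/-- `y² = x³ − 3x² + 3x = (x − 1)³ + 1`: Cremona `36a1 : y² = x³ + 1` translated to its rational
`2`-torsion point (`j = 0`, CM by `ℤ[ζ₃]`), in two-torsion normal form `[0, a, 0, b, 0]`.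
[cite: CremonaAlgorithms1997, Table 1 (class 36a)] -/
def jZeroTwoTorsionModel : WeierstrassCurve ℚ := ⟨0, -3, 0, 3, 0⟩

/-- Its Vélu `2`-isogenous curve `y² = x³ + 6x² − 3x` (`[0, −2a, 0, a² − 4b, 0]`; `j = 54000`, CM by
`ℤ[√−3]`; `≅` Cremona `36a2`). [cite: SilvermanAEC2009, III.4 Example 4.5] -/
def j54000Model : WeierstrassCurve ℚ := ⟨0, 6, 0, -3, 0⟩

/-- `[0, −3, 0, 3, 0]` is in two-torsion normal form (`a₁ = a₃ = a₆ = 0`). [folklore] -/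
instance isTwoTorsionNF_jZeroTwoTorsionModel : jZeroTwoTorsionModel.IsTwoTorsionNF := by
  unfold jZeroTwoTorsionModel; infer_instance

/-- `Δ(y² = x³ − 3x² + 3x) = −432 ≠ 0`. [folklore] -/
instance isElliptic_jZeroTwoTorsionModel : jZeroTwoTorsionModel.IsElliptic := by
  refine ⟨isUnit_iff_ne_zero.mpr ?_⟩
  norm_num [jZeroTwoTorsionModel, WeierstrassCurve.Δ, WeierstrassCurve.b₂, WeierstrassCurve.b₄,
    WeierstrassCurve.b₆, WeierstrassCurve.b₈]

/-- `Δ(y² = x³ + 6x² − 3x) = 6912 ≠ 0`. [folklore] -/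
instance isElliptic_j54000Model : j54000Model.IsElliptic := by
  refine ⟨isUnit_iff_ne_zero.mpr ?_⟩
  norm_num [j54000Model, WeierstrassCurve.Δ, WeierstrassCurve.b₂, WeierstrassCurve.b₄,
    WeierstrassCurve.b₆, WeierstrassCurve.b₈]

/-- `j(y² = x³ − 3x² + 3x) = 0` (`c₄ = 0`). [folklore] -/
theorem j_jZeroTwoTorsionModel : jZeroTwoTorsionModel.j = 0 := by
  have hc4 : jZeroTwoTorsionModel.c₄ = 0 := by
    norm_num [jZeroTwoTorsionModel, WeierstrassCurve.c₄, WeierstrassCurve.b₂, WeierstrassCurve.b₄]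
  rw [WeierstrassCurve.j, hc4]
  simp

/-- `j(y² = x³ + 6x² − 3x) = 720³/6912 = 54000`. [cite: SilvermanATAEC1994, App. A §3] -/
theorem j_j54000Model : j54000Model.j = 54000 := by
  have hc4 : j54000Model.c₄ = 720 := by
    norm_num [j54000Model, WeierstrassCurve.c₄, WeierstrassCurve.b₂, WeierstrassCurve.b₄]
  have hΔ : j54000Model.Δ = 6912 := by
    norm_num [j54000Model, WeierstrassCurve.Δ, WeierstrassCurve.b₂, WeierstrassCurve.b₄,
      WeierstrassCurve.b₆, WeierstrassCurve.b₈]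
  rw [WeierstrassCurve.j, Units.inv_mul_eq_iff_eq_mul, hc4, coe_Δ', hΔ]
  norm_num

/-- Vélu: the `2`-isogeny codomain of `y² = x³ − 3x² + 3x` IS `y² = x³ + 6x² − 3x`. [cite: SilvermanAEC2009, III.4 Example 4.5] -/
theorem twoIsogenyCodomain_jZeroTwoTorsionModel :
    jZeroTwoTorsionModel.twoIsogenyCodomain = j54000Model := by
  ext <;> norm_num [jZeroTwoTorsionModel, j54000Model, WeierstrassCurve.twoIsogenyCodomain]

/-- **`j = 54000 ~ j = 0` over `ℚ`**: `y² = x³ + 6x² − 3x ~ y² = x³ − 3x² + 3x` (the dual of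
Vélu's `2`-isogeny). [cite: SilvermanAEC2009, III.4 Example 4.5] -/
theorem isIsogenous_j54000Model : IsIsogenous j54000Model jZeroTwoTorsionModel :=
  (isIsogenous_of_eq_twoIsogenyCodomain jZeroTwoTorsionModel
    twoIsogenyCodomain_jZeroTwoTorsionModel).symm_of_charZero

/-! ## §2 Every CM curve with `3` ramified is `ℚ`-isogenous to a `j = 0` curve -/

section NormalForm

variable (W : WeierstrassCurve ℚ) [W.IsElliptic]

/-- **Isogeny normal form of the `@3` slice.** A CM elliptic curve `W/ℚ` whose CM field has `3`
ramified (`d_K = −3`, `cmRamified_three_iff_of_hasCM`, i.e. `j(W) ∈ {0, 54000, −12288000}`) is `ℚ`-isogenous to an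
elliptic curve with `j = 0`: for `j = 54000` / `−12288000`, `W` is a quadratic twist
`C • W = E^{(d)}` of the base model `E` of that `j` (Silverman X.5.4), `E ~ E₀` with `j(E₀) = 0`
(Vélu, §1 / `isIsogenous_cm27`), and `E^{(d)} ~ E₀^{(d)}` (isogenies twist).
[cite: SilvermanAEC2009, X.5 Prop. 5.4 and Cor. 5.4.1, III.4 Example 4.5]
[cite: CremonaAlgorithms1997, §3.8 and §3.9 (p. 87)] -/
theorem exists_isIsogenous_j_eq_zero (hCM : W.HasCM) (hram : CMRamified W 3) :
    ∃ (V : WeierstrassCurve ℚ) (_ : V.IsElliptic), V.j = 0 ∧ IsIsogenous W V := by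
  have hd : cmFieldDiscrOfJ W.j = -3 := (cmRamified_three_iff_of_hasCM hCM).mp hram
  have hj3 : W.j = 0 ∨ W.j = 54000 ∨ W.j = -12288000 := by
    by_contra hne
    unfold cmFieldDiscrOfJ at hd
    rw [if_neg hne] at hd
    split_ifs at hd <;> norm_num at hd
  rcases hj3 with h0 | h54 | h27
  · exact ⟨W, inferInstance, h0, isIsogenous_self W⟩
  · -- `j = 54000`
    obtain ⟨d, hd, C, hC⟩ := exists_variableChange_eq_quadraticTwist_of_j_eq (E := j54000Model)
      (h54.trans j_j54000Model.symm) (by rw [j_j54000Model]; norm_num)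
      (by rw [j_j54000Model]; norm_num)
    haveI := jZeroTwoTorsionModel.isElliptic_quadraticTwist hd
    refine ⟨jZeroTwoTorsionModel.quadraticTwist d, inferInstance, ?_, ?_⟩
    · rw [j_quadraticTwist _ hd, j_jZeroTwoTorsionModel]
    · have h1 : IsIsogenous W (j54000Model.quadraticTwist d) := hC ▸ isIsogenous_smul W C
      exact h1.trans' (isIsogenous_j54000Model.quadraticTwist hd)
  · -- `j = −12288000`
    obtain ⟨d, hd, C, hC⟩ := exists_variableChange_eq_quadraticTwist_of_j_eq
      (E := threeTorsionModel (6 : ℚ) (-4)) (h27.trans j_threeTorsionModel_cm27.symm)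
      (by rw [j_threeTorsionModel_cm27]; norm_num) (by rw [j_threeTorsionModel_cm27]; norm_num)
    haveI : (threeIsogenyCodomain (6 : ℚ) (-4)).IsElliptic := isElliptic_threeIsogenyCodomain
    haveI := (threeIsogenyCodomain (6 : ℚ) (-4)).isElliptic_quadraticTwist hd
    refine ⟨(threeIsogenyCodomain (6 : ℚ) (-4)).quadraticTwist d, inferInstance, ?_, ?_⟩
    · rw [j_quadraticTwist _ hd]
      exact j_threeIsogenyCodomain_cm27
    · have h1 : IsIsogenous W ((threeTorsionModel (6 : ℚ) (-4)).quadraticTwist d) :=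
        hC ▸ isIsogenous_smul W C
      exact h1.trans' (isIsogenous_cm27.quadraticTwist hd)

/-- **Mordell normal form.** A CM elliptic curve `W/ℚ` with `3` ramified in its CM field is
`ℚ`-isogenous to a Mordell curve `y² = x³ + k`, `k ≠ 0` (a short model of the `j = 0` curve of
`exists_isIsogenous_j_eq_zero` has `A = 0`: `j = 6912A³/(4A³ + 27B²)`).
[cite: SilvermanAEC2009, III.1 and X.5 Prop. 5.4] -/
theorem exists_isIsogenous_mordell (hCM : W.HasCM) (hram : CMRamified W 3) :
    ∃ k : ℚ, k ≠ 0 ∧ IsIsogenous W (⟨0, 0, 0, 0, k⟩ : WeierstrassCurve ℚ) := by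
  obtain ⟨V, _, hj, hWV⟩ := exists_isIsogenous_j_eq_zero W hCM hram
  obtain ⟨C, hC⟩ := V.exists_variableChange_isShortNF
  haveI := hC
  have hjS : (C • V).j = 0 := by rw [variableChange_j]; exact hj
  have hden := four_mul_a₄_cube_add_ne_zero (C • V)
  have hA : (C • V).a₄ = 0 := by
    have hj' := (C • V).j_of_isShortNF
    rw [hjS, eq_comm, div_eq_zero_iff] at hj'
    rcases hj' with h | h
    · exact pow_eq_zero_iff (n := 3) (by norm_num) |>.mp (by linarith [h])
    · exact absurd h hden
  have hB : (C • V).a₆ ≠ 0 := by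
    intro hB
    apply hden
    rw [hA, hB]; ring
  have hS : C • V = ⟨0, 0, 0, 0, (C • V).a₆⟩ := by
    ext
    · exact a₁_of_isShortNF _
    · exact a₂_of_isShortNF _
    · exact a₃_of_isShortNF _
    · exact hA
    · rfl
  refine ⟨(C • V).a₆, hB, ?_⟩
  rw [← hS]
  exact hWV.trans' (isIsogenous_smul V C)

/-- The `j = 0` curve may be taken GLOBALLY MINIMAL (Néron, *AEC* VIII.8.3, tree
`exists_isGloballyMinimal_model`): `W ~ V`, `V` globally minimal elliptic with `j(V) = 0`.
[cite: SilvermanAEC2009, VIII.8 Cor. 8.3] -/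
theorem exists_isIsogenous_j_eq_zero_minimal (hCM : W.HasCM) (hram : CMRamified W 3) :
    ∃ (V : WeierstrassCurve ℚ) (_ : V.IsElliptic) (_ : V.IsGloballyMinimal),
      V.j = 0 ∧ IsIsogenous W V := by
  obtain ⟨V, _, hj, hWV⟩ := exists_isIsogenous_j_eq_zero W hCM hram
  obtain ⟨C, hC⟩ := hasGlobalMinimalModel_rat_holds V
  haveI := hC
  exact ⟨C • V, inferInstance, hC, by rw [variableChange_j, hj], hWV.trans' (isIsogenous_smul V C)⟩

end NormalForm

/-! ## §3 The crux C1 of route PrintCFram is equivalent to its `j = 0` restriction -/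

/-- **C1 ⟺ C1 restricted to `j = 0`.** Granted GZK (`hGZK`: finiteness of `Ш`, `rank = r_an` in
analytic rank `≤ 1`), modularity (`hmod`: `L^{(r)}(E,1)/r! ≠ 0`) and Cassels' isogeny invariance
of the BSD quotient (`hCassels`): BSD(E,3) for EVERY globally minimal CM curve of analytic rank one
with `3` ramified in the CM field ⟺ BSD(E,3) for every globally minimal curve with `j = 0` of
analytic rank one. (→) `j = 0` ⟹ CM ∧ `CMRamified W 3` (`JZeroThreeDescent` §1). (←) transport
along `W ~ V` of `exists_isIsogenous_j_eq_zero_minimal`: `r_an` is an isogeny invariant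
(Faltings, `analyticRank_eq_of_isIsogenous'`) and so is `BSD(·,3)` (`Wuthrich2014.bsdp_of_isIsogenous`).
[cite: MilneADT2006, Thm. I.7.3] [cite: Miller2011LMS, §1 and Def. 1.1] -/
theorem cmRamifiedThreeBSD_iff_jZero (hGZK : rank_eq_analyticRank_of_analyticRank_le_one)
    (hmod : hasEntireLFunction_rat) (hCassels : bsdRHS_eq_of_isIsogenous) :
    (∀ (W : WeierstrassCurve ℚ) [W.IsElliptic] [W.IsGloballyMinimal],
        W.HasCM → W.analyticRank = 1 → CMRamified W 3 → BSDp W 3) ↔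
      (∀ (W : WeierstrassCurve ℚ) [W.IsElliptic] [W.IsGloballyMinimal],
        W.j = 0 → W.analyticRank = 1 → BSDp W 3) := by
  haveI : Fact (Nat.Prime 3) := ⟨Nat.prime_three⟩
  constructor
  · intro h W _ _ hj hr
    exact h W (W.hasCM_of_j_eq_zero hj) hr (cmRamified_three_of_j_eq_zero W hj)
  · intro h W _ _ hCM hr hram
    obtain ⟨V, _, _, hj, hWV⟩ := exists_isIsogenous_j_eq_zero_minimal W hCM hram
    have hrV : V.analyticRank = 1 := by rw [← analyticRank_eq_of_isIsogenous' hWV, hr]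
    have hbV : BSDp V 3 := h V hj hrV
    exact Wuthrich2014.bsdp_of_isIsogenous hCassels hWV (hGZK V hrV.le).2
      (WeierstrassCurve.leadingLCoeff_ne_zero_holds (hmod V)) hbV

/-- **The same in leaf vocabulary**: `WAllCornerFRamifiedAtThree` (W-ALL row 12r at `3`, the RHS
of `wAllCornerFRamifiedAtThree_iff_three`) ⟺ its `j = 0` restriction, granted GZK, modularity,
Cassels. [cite: MilneADT2006, Thm. I.7.3] [cite: Miller2011LMS, §1 and Def. 1.1] -/
theorem wAllCornerFRamifiedAtThree_iff_jZero (hGZK : rank_eq_analyticRank_of_analyticRank_le_one)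
    (hmod : hasEntireLFunction_rat) (hCassels : bsdRHS_eq_of_isIsogenous) :
    WAllCornerFRamifiedAtThree ↔
      (∀ (W : WeierstrassCurve ℚ) [W.IsElliptic] [W.IsGloballyMinimal],
        W.j = 0 → W.analyticRank = 1 → BSDp W 3) := by
  rw [wAllCornerFRamifiedAtThree_iff_three]
  exact cmRamifiedThreeBSD_iff_jZero hGZK hmod hCassels

/-- **Mordell form of the reduction (unconditional)**: the leaf at `3` ⟺ BSD(V,3) for every
globally minimal `V` of analytic rank one that is `ℚ`-isogenous to some Mordell curve `y² = x³ + k`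
(`k ≠ 0`) — no BSD transport is needed in this form (CM and `CMRamified` are isogeny invariants,
`X12.CMIsogenyInvariance`). [cite: SilvermanAEC2009, X.5 Prop. 5.4] -/
theorem wAllCornerFRamifiedAtThree_iff_mordell :
    WAllCornerFRamifiedAtThree ↔
      (∀ (V : WeierstrassCurve ℚ) [V.IsElliptic] [V.IsGloballyMinimal] (k : ℚ), k ≠ 0 →
        IsIsogenous V (⟨0, 0, 0, 0, k⟩ : WeierstrassCurve ℚ) → V.analyticRank = 1 → BSDp V 3) := by
  rw [wAllCornerFRamifiedAtThree_iff_three]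
  haveI : Fact (Nat.Prime 3) := ⟨Nat.prime_three⟩
  constructor
  · intro h V _ _ k hk hiso hr
    haveI : (⟨0, 0, 0, 0, k⟩ : WeierstrassCurve ℚ).IsElliptic := by
      refine ⟨isUnit_iff_ne_zero.mpr ?_⟩
      have : (⟨0, 0, 0, 0, k⟩ : WeierstrassCurve ℚ).Δ = -432 * k ^ 2 := by
        norm_num [WeierstrassCurve.Δ, WeierstrassCurve.b₂, WeierstrassCurve.b₄,
          WeierstrassCurve.b₆, WeierstrassCurve.b₈]
        ring
      rw [this]
      exact mul_ne_zero (by norm_num) (pow_ne_zero _ hk)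
    have hjk : (⟨0, 0, 0, 0, k⟩ : WeierstrassCurve ℚ).j = 0 := by
      have hc4 : (⟨0, 0, 0, 0, k⟩ : WeierstrassCurve ℚ).c₄ = 0 := by
        norm_num [WeierstrassCurve.c₄, WeierstrassCurve.b₂, WeierstrassCurve.b₄]
      rw [WeierstrassCurve.j, hc4]
      simp
    have hCMk : (⟨0, 0, 0, 0, k⟩ : WeierstrassCurve ℚ).HasCM := hasCM_of_j_eq_zero _ hjk
    have hCM : V.HasCM := (X12.hasCM_iff_of_isIsogenous hiso).mpr hCMk
    have hram : CMRamified V 3 :=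
      (X12.cmRamified_iff_of_isIsogenous hiso hCM 3).mpr (cmRamified_three_of_j_eq_zero _ hjk)
    exact h V hCM hr hram
  · intro h W _ _ hCM hr hram
    obtain ⟨k, hk, hiso⟩ := exists_isIsogenous_mordell W hCM hram
    exact h W k hk hiso hr

end Summit.BirchSwinnertonDyer.Rank1Residual.X12.JZeroThree

end
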